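import Literature.IUT.LogVolume.DHAvgDifferentBound
import Mathlib.NumberTheory.RamificationInertia.Galois
import HarnessLib

/-!
# Dupuy–Hilado (arXiv:2004.13108v2) (7.18) AS PRINTED — `ln(Diff) ≤ ln(rad|Disc(K/ℚ)|·[K:ℚ])` — holds at
# every genuine section datum when `K/ℚ` is Galois

PROOF-ONLY sequel of `DHAvgDifferentBound` (T. Dupuy, A. Hilado, arXiv:2004.13108v2 [DupuyHilado2020],
UNREFEREED; held render `book:anonnd-2004-13108v2`, locators `p.N l.M`). No new definition, no new `Prop`
fact. Cited BY NAME: `SectionRamification.ofLift`, `lnAvgDifferent`, `avgDiffExp_mul_log`,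
`rpow_diff_ofLift_le` (`p^{diff(v̲/p)} ≤ p·p^{v_p [K_v̲:ℚ_p]}`), `one_le_sum_rpow_diff_mul_weight`,
`sum_rpow_diff_mul_weight_ofLift_eq_one_of_not_dvd`, `sum_weight` (this directory); Mathlib's Hilbert theory
(`Ideal.card_stabilizer_eq`: `|D(w|p)| = e(w|p)·f(w|p)` for `Gal(K/ℚ)` acting on `𝓞 K`).

## What is PROVED

Footnote 10 (p.29 l.44–60) bounds `p^{diff_p} ≤ p·p^{ord_p [K:ℚ]}` (l.54) and multiplies over `p` (l.56–59:
"`Diff(V/ℚ) ≤ Π_p p·p^{ord_p[K:ℚ]} = rad(|Disc(K/ℚ)|)·[K:ℚ]`", the product over the primes where `diff_p ≠ 0`,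
i.e. `p ∣ Disc(K/ℚ)`). The step `p^{ord_p e(v̲/p)} ≤ p^{ord_p [K:ℚ]}` holds as soon as the local degrees
`[K_v̲:ℚ_p]` divide `[K:ℚ]`, which is the case for `K/ℚ` GALOIS:

* `localDeg_dvd_finrank_of_isGalois` — `K/ℚ` Galois ⇒ `[K_w:ℚ_p] = e(w|p)f(w|p) ∣ [K:ℚ]` (the decomposition
  group has order `e f`, Lagrange);
* `sum_rpow_diff_mul_weight_ofLift_le_of_isGalois` — `Σ_{v|p} Pr(v)·p^{diff(v̲/p)} ≤ p·p^{v_p [K:ℚ]}`;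
* (private) `Σ_{p | D} v_p(d)·ln p ≤ ln d` (`d = Π_p p^{v_p d}`, Mathlib `Real.log_nat_eq_sum_factorization`);
* `lnAvgDifferent_ofLift_le_of_isGalois` — **(7.18) AS PRINTED, `ln Diff(V̲/ℚ) ≤ ln(rad|Disc(K/ℚ)|·[K:ℚ])`,
  for every finite set `T` of primes, at every genuine section datum of a Galois number field `K/ℚ`.**

In the setting of Thm 1.0.4 (`K = F(E_F[l])`, [IUTchI] Def. 3.1 (c)) only `K/F_mod` Galois is available
(Rmk. 3.1.5), so this file records the exact sufficient hypothesis of the printed derivation; the Θ-datum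
consumer uses the unconditional (7.18)♯ of `DHAvgDifferentBound` instead (`DHBabySzpiroDegreeFloor`).

HONEST FRAMING: classical algebraic number theory only; nothing here bears on [IUTchIII] Cor. 3.12
[claim: Mochizuki2012, status: disputed] or Claim 5.0.1 [claim: DupuyHilado2020, status: under-review].
Typed ≠ proved ≠ endorsed; no side is taken on any author; no abc claim.
-/

noncomputable section

namespace Literature.IUT.LogVolume

open NumberField IsDedekindDomain Finset Literature.NumberTheory.NumberFields

/-! ## Classical inputs -/
section Classical

variable (K : Type) [Field K] [NumberField K]

/-- **`K/ℚ` Galois ⇒ `[K_w:ℚ_p] ∣ [K:ℚ]`**: `n_w = e(w|p)·f(w|p)` is the order of the decomposition group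
`D(w|p) ≤ Gal(K/ℚ)` (Mathlib `Ideal.card_stabilizer_eq`), which divides `|Gal(K/ℚ)| = [K:ℚ]`.
[cite: NeukirchANT1999, Ch. I §9 Prop. (9.6)] -/
theorem localDeg_dvd_finrank_of_isGalois [IsGalois ℚ K] (w : HeightOneSpectrum (𝓞 K)) :
    localDeg K w ∣ Module.finrank ℚ K := by
  haveI : w.asIdeal.IsMaximal := w.isMaximal
  haveI : IsGaloisGroup (K ≃ₐ[ℚ] K) ℤ (𝓞 K) := IsGaloisGroup.of_isFractionRing _ _ _ ℚ K
  have h := Ideal.card_stabilizer_eq (G := K ≃ₐ[ℚ] K) (w.asIdeal.under ℤ) w.asIdeal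
  rw [Ideal.ramificationIdxIn_eq_ramificationIdx (w.asIdeal.under ℤ) w.asIdeal (K ≃ₐ[ℚ] K),
    Ideal.inertiaDegIn_eq_inertiaDeg (w.asIdeal.under ℤ) w.asIdeal (K ≃ₐ[ℚ] K)] at h
  rw [localDeg, ← h, ← IsGalois.card_aut_eq_finrank]
  exact Subgroup.card_subgroup_dvd_card _

/-- `Σ_{p | D} v_p(d)·ln p ≤ ln d` for natural numbers `d ≠ 0`, `D ≠ 0` (`ln d = Σ_{p | d} v_p(d)·ln p`, Mathlib
`Real.log_nat_eq_sum_factorization`; the terms at `p ∤ d` vanish). Private helper. [folklore] -/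
private theorem sum_padicValNat_mul_log_primeFactors_le (d D : ℕ) (hd : d ≠ 0) :
    ∑ p ∈ D.primeFactors, (padicValNat p d : ℝ) * Real.log p ≤ Real.log d := by
  have hlog : Real.log d = ∑ p ∈ d.primeFactors, (padicValNat p d : ℝ) * Real.log p := by
    rw [Real.log_nat_eq_sum_factorization, Finsupp.sum, Nat.support_factorization]
    refine Finset.sum_congr rfl fun p hp => ?_
    rw [Nat.factorization_def d (Nat.prime_of_mem_primeFactors hp)]
  have hvanish : ∀ p ∈ D.primeFactors, p ∉ d.primeFactors → (padicValNat p d : ℝ) * Real.log p = 0 := by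
    intro p hp hnot
    have hpr := Nat.prime_of_mem_primeFactors hp
    have hnd : ¬ p ∣ d := fun h => hnot (Nat.mem_primeFactors.mpr ⟨hpr, h, hd⟩)
    haveI : Fact p.Prime := ⟨hpr⟩
    rw [padicValNat.eq_zero_of_not_dvd hnd]
    simp
  rw [hlog, ← Finset.sum_filter_of_ne (s := D.primeFactors) (p := fun p => p ∈ d.primeFactors)
    (fun p hp hne => by_contra fun hnot => hne (hvanish p hp hnot))]
  refine Finset.sum_le_sum_of_subset_of_nonneg (fun p hp => (Finset.mem_filter.mp hp).2) ?_
  intro p _ _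
  exact mul_nonneg (Nat.cast_nonneg _) (Real.log_natCast_nonneg p)

end Classical

namespace ExplicitSzpiro

variable {F₀ : Type} [Field F₀] [NumberField F₀]

section OfLift

variable (K : Type) [Field K] [NumberField K] (lift : HeightOneSpectrum (𝓞 F₀) → HeightOneSpectrum (𝓞 K))

/-- **`K/ℚ` Galois: `p^{diff(v̲/p)} ≤ p·p^{v_p [K:ℚ]}`** for `v ∈ V(F₀)_p` (`v_p [K_v̲:ℚ_p] ≤ v_p [K:ℚ]` since
`[K_v̲:ℚ_p] ∣ [K:ℚ]`) — footnote 10's per-place bound (p.29 l.45–54) under its sufficient hypothesis.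
[cite: DupuyHilado2020, footnote 10 p.29 l.44–54] -/
theorem SectionRamification.rpow_diff_ofLift_le_of_isGalois [IsGalois ℚ K]
    (hlift : ∀ v, residueChar K (lift v) = residueChar F₀ v)
    (p : ℕ) [Fact p.Prime] (v : HeightOneSpectrum (𝓞 F₀)) (hv : v ∈ placesOver F₀ p) :
    (p : ℝ) ^ (SectionRamification.ofLift K lift).diff v ≤
      p * ((p ^ padicValNat p (Module.finrank ℚ K) : ℕ) : ℝ) := by
  have h1 := SectionRamification.rpow_diff_ofLift_le K lift hlift p v hv
  have hdvd : localDegree K (lift v) ∣ Module.finrank ℚ K := by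
    rw [← localDeg_eq_localDegree]; exact localDeg_dvd_finrank_of_isGalois K (lift v)
  have hd0 : Module.finrank ℚ K ≠ 0 := Module.finrank_pos.ne'
  have hle : padicValNat p (localDegree K (lift v)) ≤ padicValNat p (Module.finrank ℚ K) :=
    (padicValNat_dvd_iff_le hd0).mp (dvd_trans pow_padicValNat_dvd hdvd)
  have h2 : ((p ^ padicValNat p (localDegree K (lift v)) : ℕ) : ℝ) ≤
      ((p ^ padicValNat p (Module.finrank ℚ K) : ℕ) : ℝ) := by
    exact_mod_cast Nat.pow_le_pow_right (Fact.out : p.Prime).pos hle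
  exact h1.trans (mul_le_mul_of_nonneg_left h2 (by positivity))

/-- `K/ℚ` Galois: `Σ_{v|p} Pr(v)·p^{diff(v̲/p)} ≤ p·p^{v_p [K:ℚ]}` — footnote 10's "`p^{diff_p} ≤ p·p^{ord_p[K:ℚ]}`"
(p.29 l.54). [cite: DupuyHilado2020, footnote 10 p.29 l.44–54] -/
theorem SectionRamification.sum_rpow_diff_mul_weight_ofLift_le_of_isGalois [IsGalois ℚ K]
    (hlift : ∀ v, residueChar K (lift v) = residueChar F₀ v) (p : ℕ) [Fact p.Prime] :
    ∑ v ∈ placesOver F₀ p, (p : ℝ) ^ (SectionRamification.ofLift K lift).diff v * weight F₀ v ≤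
      p * ((p ^ padicValNat p (Module.finrank ℚ K) : ℕ) : ℝ) := by
  calc ∑ v ∈ placesOver F₀ p, (p : ℝ) ^ (SectionRamification.ofLift K lift).diff v * weight F₀ v
      ≤ ∑ v ∈ placesOver F₀ p, ((p : ℝ) * ((p ^ padicValNat p (Module.finrank ℚ K) : ℕ) : ℝ)) * weight F₀ v :=
        Finset.sum_le_sum fun v hv => mul_le_mul_of_nonneg_right
          (SectionRamification.rpow_diff_ofLift_le_of_isGalois K lift hlift p v hv) (weight_nonneg F₀ v)
    _ = p * ((p ^ padicValNat p (Module.finrank ℚ K) : ℕ) : ℝ) := by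
        rw [← Finset.mul_sum, sum_weight, mul_one]

/-- `K/ℚ` Galois, per prime: `diff_p·ln p ≤ ln p + v_p([K:ℚ])·ln p` if `p ∣ Disc(K/ℚ)`, `= 0` otherwise.
[cite: DupuyHilado2020, footnote 10 p.29 l.44–60] -/
theorem SectionRamification.avgDiffExp_mul_log_ofLift_le_of_isGalois [IsGalois ℚ K]
    (hlift : ∀ v, residueChar K (lift v) = residueChar F₀ v) (p : ℕ) [Fact p.Prime] :
    (SectionRamification.ofLift K lift).avgDiffExp p * Real.log p ≤
      if p ∣ (NumberField.discr K).natAbs then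
        Real.log p + (padicValNat p (Module.finrank ℚ K) : ℝ) * Real.log p else 0 := by
  rw [SectionRamification.avgDiffExp_mul_log]
  split_ifs with hD
  · have h1 := SectionRamification.one_le_sum_rpow_diff_mul_weight (SectionRamification.ofLift K lift) p
    have hp0 : (0 : ℝ) < p := by exact_mod_cast (Fact.out : p.Prime).pos
    have hq0 : (0 : ℝ) < ((p ^ padicValNat p (Module.finrank ℚ K) : ℕ) : ℝ) := by
      exact_mod_cast pow_pos (Fact.out : p.Prime).pos _
    calc Real.log (∑ v ∈ placesOver F₀ p, (p : ℝ) ^ (SectionRamification.ofLift K lift).diff v * weight F₀ v)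
        ≤ Real.log ((p : ℝ) * ((p ^ padicValNat p (Module.finrank ℚ K) : ℕ) : ℝ)) :=
          Real.log_le_log (by linarith)
            (SectionRamification.sum_rpow_diff_mul_weight_ofLift_le_of_isGalois K lift hlift p)
      _ = Real.log p + (padicValNat p (Module.finrank ℚ K) : ℝ) * Real.log p := by
          rw [Real.log_mul hp0.ne' hq0.ne']
          push_cast
          rw [Real.log_pow]
  · rw [SectionRamification.sum_rpow_diff_mul_weight_ofLift_eq_one_of_not_dvd K lift hlift p hD,
      Real.log_one]

/-- **(7.18) AS PRINTED, PROVED for `K/ℚ` Galois at every genuine section datum**: for a finite set `T` of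
primes, `ln Diff(V̲/ℚ) ≤ ln(rad|Disc(K/ℚ)|·[K:ℚ])` — footnote 10 verbatim (per prime `p·p^{v_p[K:ℚ]}` at the
ramified primes, `Π_{p | Disc} p^{v_p [K:ℚ]} ≤ [K:ℚ]`). [cite: DupuyHilado2020, (7.18) p.29 l.3; footnote 10 p.29 l.44–60] -/
theorem SectionRamification.lnAvgDifferent_ofLift_le_of_isGalois [IsGalois ℚ K]
    (hlift : ∀ v, residueChar K (lift v) = residueChar F₀ v) (T : Finset ℕ) (hT : ∀ p ∈ T, p.Prime) :
    (SectionRamification.ofLift K lift).lnAvgDifferent T ≤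
      Real.log ((∏ p ∈ (NumberField.discr K).natAbs.primeFactors, (p : ℝ)) * Module.finrank ℚ K) := by
  have hD0 : (NumberField.discr K).natAbs ≠ 0 := Int.natAbs_ne_zero.mpr (NumberField.discr_ne_zero K)
  have hd0 : Module.finrank ℚ K ≠ 0 := Module.finrank_pos.ne'
  -- per prime, supported on the prime divisors of `D`
  have h : ∑ p ∈ T, (SectionRamification.ofLift K lift).avgDiffExp p * Real.log p ≤
      ∑ p ∈ (NumberField.discr K).natAbs.primeFactors,
        (Real.log p + (padicValNat p (Module.finrank ℚ K) : ℝ) * Real.log p) := by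
    calc ∑ p ∈ T, (SectionRamification.ofLift K lift).avgDiffExp p * Real.log p
        ≤ ∑ p ∈ T, (if p ∣ (NumberField.discr K).natAbs then
            Real.log p + (padicValNat p (Module.finrank ℚ K) : ℝ) * Real.log p else 0) :=
          Finset.sum_le_sum fun p hp => by
            haveI : Fact p.Prime := ⟨hT p hp⟩
            exact SectionRamification.avgDiffExp_mul_log_ofLift_le_of_isGalois K lift hlift p
      _ = ∑ p ∈ T.filter (fun p => p ∣ (NumberField.discr K).natAbs),
            (Real.log p + (padicValNat p (Module.finrank ℚ K) : ℝ) * Real.log p) :=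
          (Finset.sum_filter _ _).symm
      _ ≤ ∑ p ∈ (NumberField.discr K).natAbs.primeFactors,
            (Real.log p + (padicValNat p (Module.finrank ℚ K) : ℝ) * Real.log p) :=
          Finset.sum_le_sum_of_subset_of_nonneg (fun p hp => by
            rw [Finset.mem_filter] at hp
            exact Nat.mem_primeFactors.mpr ⟨hT p hp.1, hp.2, hD0⟩)
            (fun p _ _ => add_nonneg (Real.log_natCast_nonneg p)
              (mul_nonneg (Nat.cast_nonneg _) (Real.log_natCast_nonneg p)))
  have hrad : ∑ p ∈ (NumberField.discr K).natAbs.primeFactors, Real.log p =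
      Real.log (∏ p ∈ (NumberField.discr K).natAbs.primeFactors, (p : ℝ)) := by
    rw [Real.log_prod]
    exact fun p hp => by exact_mod_cast (Nat.prime_of_mem_primeFactors hp).ne_zero
  have hval := sum_padicValNat_mul_log_primeFactors_le (Module.finrank ℚ K) (NumberField.discr K).natAbs hd0
  have hr0 : (∏ p ∈ (NumberField.discr K).natAbs.primeFactors, (p : ℝ)) ≠ 0 :=
    Finset.prod_ne_zero_iff.mpr fun p hp => by exact_mod_cast (Nat.prime_of_mem_primeFactors hp).ne_zero
  have hdR : (Module.finrank ℚ K : ℝ) ≠ 0 := by exact_mod_cast hd0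
  unfold SectionRamification.lnAvgDifferent
  rw [Real.log_mul hr0 hdR, ← hrad]
  rw [Finset.sum_add_distrib] at h
  linarith

end OfLift

end ExplicitSzpiro

end Literature.IUT.LogVolume

end
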